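import Summits.BirchSwinnertonDyer.BirchSwinnertonDyer.Theorems.Rank2ObservatoryRank3TwoDescCensusPart1
import Summits.BirchSwinnertonDyer.BirchSwinnertonDyer.Theorems.Rank2ObservatoryRank3TwoDescCensusPart2
import Summits.BirchSwinnertonDyer.BirchSwinnertonDyer.Theorems.Rank2ObservatoryRank3TwoDescCensusPart3
import Summits.BirchSwinnertonDyer.BirchSwinnertonDyer.Theorems.Rank2ObservatoryRank3TwoDescCensusPart4
import Summits.BirchSwinnertonDyer.BirchSwinnertonDyer.Theorems.Rank2ObservatoryRank3TwoDescCensusPart5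
import Summits.BirchSwinnertonDyer.BirchSwinnertonDyer.Theorems.Rank2ObservatoryRank3TwoDescCensusPart6
import Summits.BirchSwinnertonDyer.BirchSwinnertonDyer.Theorems.Rank2ObservatoryRank3TwoDescCensusPart7
import Summits.BirchSwinnertonDyer.BirchSwinnertonDyer.Theorems.Rank2ObservatoryRank3TwoDescCensusPart8
import HarnessLib

/-!
# BirchSwinnertonDyer — rank ≥ 2 observatory: KERNEL-2DESC rank-3 CENSUS AGGREGATE (962 rows of `rank3Table`, `rank_ℤ = 3` hypothesis-free)

HONEST FRAMING: per-curve certified theorems and census instruments; no claim on BSD in rank ≥ 2.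

`TwoDescRank3Census.rows` (DATA) = `Part1.rows ++ (… ++ Part8.rows)` lists the 962 rows of the rank-3 census table
`rank3Table` (9 487 rows) joined by the census-join files `Rank2ObservatoryRank3TwoDescRows001 … 108` (108 files;
parts `…TwoDescCensusPart1 … Part8` hold the literal lists, split for the 400-line file limit): the odd-torsion rows whose
2-division field is one of the tier-0 cubic fields landed by cert-3 (`Rank2ObservatoryCubicField<Tag>[PID].lean`) and whose
per-curve general 2-descent `Rank2Observatory<label>TwoDescRankThree.lean` (exactly 8 admissible classes by `decide`; Cassels'
`x − θ` map over the cubic field) is in the tree.  For every listed row BOTH `r ∈ rank3Table` and `rank_ℤ(E_r(ℚ)) = 3` hold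
with NO hypothesis (`mem_rank3Table`, `rank_eq_three`, glued from the parts by `List.forall_mem_append`; nothing is
re-checked here).  `rows_length : rows.length = 962`.  Sorry-free.
SCOPE: 962 of the 993 tier-0 odd-torsion rows of the KERNEL-2DESC rank-3 data jobs (j131165 / j131162 / j130689 / j130688); the
other 31 rows were not joined yet when this aggregate was written (for most of them the cubic field still lacked its
class-number-one companion `…PID.lean`, the rest await a join file); a later revision adds parts (every fact is per row,
so an extension only appends).
References: J. W. S. Cassels, *Lectures on Elliptic Curves* (1991) §15; J. E. Cremona, *Algorithms for Modular Elliptic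
Curves* (2nd ed. 1997) Tables, §3.5, §3.6.
-/

-- single-conjunct summit: `Summit.BirchSwinnertonDyer.BirchSwinnertonDyer.…` repeats the name by design
set_option linter.dupNamespace false
-- deep literal lists behind the part definitions: raise the recursion budget for the whole file
set_option maxRecDepth 400000

namespace Summit.BirchSwinnertonDyer.BirchSwinnertonDyer.Rank2Observatory.TwoDescRank3Census

open Literature Literature.NumberTheory.EllipticCurves WeierstrassCurve

/-- `∀`-over-membership is additive under `++`. -/
private theorem forall_app {P : Rank3Row → Prop} {l₁ l₂ : List Rank3Row} (h₁ : ∀ r ∈ l₁, P r) (h₂ : ∀ r ∈ l₂, P r) :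
    ∀ r ∈ l₁ ++ l₂, P r :=
  List.forall_mem_append.2 ⟨h₁, h₂⟩

/-- DATA: all 962 joined rows = `Part1.rows ++ (… ++ Part8.rows)` (parts in join-file order). [cite: CremonaAlgorithms1997, Tables] -/
def rows : List Rank3Row :=
  Part1.rows ++ (Part2.rows ++ (Part3.rows ++ (Part4.rows ++ (Part5.rows ++ (Part6.rows ++ (Part7.rows ++
    (Part8.rows)))))))

/-- `rows.length = 962` (= 135 + 135 + 135 + 135 + 135 + 125 + 135 + 27). -/
theorem rows_length : rows.length = 962 := by
  simp only [rows, List.length_append, Part1.rows_length, Part2.rows_length, Part3.rows_length, Part4.rows_length, Part5.rows_length, Part6.rows_length, Part7.rows_length, Part8.rows_length]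

/-- **Every listed row is a row of the census table `rank3Table`.** [cite: CremonaAlgorithms1997, Tables] -/
theorem mem_rank3Table : ∀ r ∈ rows, r ∈ rank3Table := by
  unfold rows
  exact forall_app Part1.mem_rank3Table (forall_app Part2.mem_rank3Table (forall_app Part3.mem_rank3Table
    (forall_app Part4.mem_rank3Table (forall_app Part5.mem_rank3Table (forall_app Part6.mem_rank3Table
    (forall_app Part7.mem_rank3Table (Part8.mem_rank3Table)))))))

/-- **`rank_ℤ E_r(ℚ) = 3` for every one of the 962 listed census rows, NO hypothesis** (kernel 2-descent upper bound +
kernel point certificate, per row). [cite: Cassels1991LecturesEllipticCurves, §15] [cite: CremonaAlgorithms1997, §3.5] -/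
theorem rank_eq_three : ∀ r ∈ rows, r.curve.mordellWeilRank = 3 := by
  unfold rows
  exact forall_app Part1.rank_eq_three (forall_app Part2.rank_eq_three (forall_app Part3.rank_eq_three
    (forall_app Part4.rank_eq_three (forall_app Part5.rank_eq_three (forall_app Part6.rank_eq_three
    (forall_app Part7.rank_eq_three (Part8.rank_eq_three)))))))

/-- Both facts per listed row. [cite: CremonaAlgorithms1997, Tables] -/
theorem rank_eq_three_and_mem : ∀ r ∈ rows, r ∈ rank3Table ∧ r.curve.mordellWeilRank = 3 :=
  fun r hr => ⟨mem_rank3Table r hr, rank_eq_three r hr⟩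

end Summit.BirchSwinnertonDyer.BirchSwinnertonDyer.Rank2Observatory.TwoDescRank3Census
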